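import Summits.BirchSwinnertonDyer.Rank1Residual.X11b.VisibilityRankOne
import Summits.BirchSwinnertonDyer.Rank1Residual.GaloisImage.FrobeniusOrderWitness
import Summits.BirchSwinnertonDyer.Rank1Residual.X11b.CertificateCheckBridge
import Summits.BirchSwinnertonDyer.Rank1Residual.GaloisImage.ThreeCongruenceHesseCertificateLemmas
import Literature.NumberTheory.EllipticCurves.Fisher2012.HesseFamilyThreeReverseProofs
import Summits.BirchSwinnertonDyer.Rank1Residual.Visibility.TwoWitnessLowerHalf317400y1
import Summits.BirchSwinnertonDyer.Rank1Residual.Visibility.RankOnePairs2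
import Summits.BirchSwinnertonDyer.Rank1Residual.Visibility.TwoWitnessLowerHalf338919c1
import Summits.BirchSwinnertonDyer.Rank1Residual.Visibility.TwoWitnessLowerHalf355008bg1
import HarnessLib

/-!
# BSD rank-≤1 residual cell: rank-one TWO-WITNESS visibility compositions at `p = 3` (VIS-2W), file 9 — `317400y1` (X11b), `338919c1` (X11b), `355008bg1` (X11b)

HONEST FRAMING (cell `b2b-bsdres-*`, run/shared/lean/b2b/bsd-rank1-residual/, verbatim): the goal of the cell is to DELETE the
COMBINATION-SHAPED residual classes for ALL analytic-rank `≤ 1` elliptic curves over `ℚ` — "full BSD formula for every rank `≤ 1`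
curve in class C" assembled STRICTLY from published theorems — so that the rank-`≤ 1` remainder becomes exactly the
CONSTRUCTION-SHAPED classes, which are TYPED (missing-input Props), NOT attempted; this is not "finishing BSD". Prove what is
provable now; shrink each hard class to its core with data; no claim beyond stated classes. Unit `b2b-bsdres-x11c` GEN 34
(lit GEN 146 wake item (ii) «VIS-2W»). THEOREMS ONLY (no definition, no named fact introduced); PER PAIR (a certificate shape),
NOT a class theorem; classes X11b / X7 stay as labelled; nothing is booked by this file; the desk prices.

## What this file does

**This file (VIS30-NOLOC):** its keys are VIS30 keys (x11c gen 6 doors `bsdp_v<E>` in `Visibility/RankOnePairs*`, n1011 twins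
`bsdpHesse_v<E>` in `…ThetaFree*`) on which EVERY binder of the gen-6 lever holds; those doors still DISPLAY the partner's local
torsion `hloc` (`E'(ℚ_v)[3] = 0` on `S`, a two-engine NUMERIC certificate) and — in `bsdp_v` — the partner's rank `hrank`. Re-composing
the same keys on k1-c3's KERNEL two-witness lower half (parked records, re-homed here) removes both: the new door `bsdpHesse_w<E>` carries
ONLY hCT hGZK [hMR] hW hKo hB hK hH hP hnt hI hr hs hv. Nothing else changes; the VIS30 doors stay in the tree; nothing booked.

The x11c gen-4/6 rank-one visibility lever (`X11b.bsdp_of_kolyvagin_of_congr`, VIS30 `Visibility/RankOnePairs*`) needs ONE rank-`≥ 3`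
partner `E'` with `E'(ℚ_v)[3] = 0` at EVERY place of `S` — the binder that FAILS (`vis:loc-fails`, hyp ENGINE V `vis_rows.tsv`) on the
OPEN keys below. Team `bsd-addord` seat k1-c3 (gen 7) replaced that local condition by TWO explicit witnesses `T₁, T₂ ∈ E'(ℚ)`,
independent mod `3E'(ℚ)` and `3`-divisible (or harmless) at every place of `S` (doors p479804 / p488071, cell-free; kernel records
`missingLowerBoundAt_c<E>_3_of_congr`, re-homed here as `Visibility/TwoWitnessLowerHalf<E>.lean`) = the LOWER half
`ord₃ #Ш_an ≤ ord₃ #Ш`. This file COMPOSES, per key, that lower half BY NAME with Kolyvagin's UPPER half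
`ord₃ #Ш(E/ℚ) ≤ 2·ord₃ [E(K):ℤ y_K] ≤ 2` (`X11b.padicValNat_shaOrder_le_of_kolyvagin`: named facts `kolyvagin` (hKo) and
`Kolyvagin1990_padicValNat_card_sha_le` (hB) = McCallum 1991 §1 / Gross 1991 Thm 1.3, both PUBLISHED; the lane's Heegner datum
with `ord₃ [E(K):ℤP] ≤ 1` DISPLAYED as binders hK hH hP hnt hI) and `ρ̄_{E,3}` ONTO decided IN THE KERNEL (two Frobenius point counts,
`GaloisImage/FrobeniusOrderWitness`, or the landed `SecondDescent.surj3_s<E>` by name), into `bsdp_w<E> : … → θ → BSDp W 3` in the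
exact binder grammar of VIS30's `bsdp_v<label>` (hCT hGZK [hMR] W hW hKo hB hK hH hP hnt hI hr hs hv W' hW' θ hθ). The `3`-congruence
`θ : E'[3] ≃ E[3]` stays a DISPLAYED HYPOTHESIS TERM, certified outside the kernel by the Kraus–Oesterlé / Sturm bound with TWO engines
to the FULL bound (numbers per theorem). Nothing else is assumed: `E(ℚ)[3] = 0`, minimality, irreducibility, the local options of
the witnesses, independence and good reduction off `S` are kernel facts of the lower-half file.

References: [McCallumLMS1991] §1; [GrossLMS1991] Thm. 1.3; [CremonaMazur2000] §3; [AgasheStein2002] Lemma 3.6 / Thm. 3.1;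
[KrausOesterle1992] Prop. 4; [Serre1972] §2.4 Prop. 15; [MazurRubin2004] (Kolyvagin systems) resp. the tree's `selmerLocalKer_iff_of_goodReduction_above`
binder hMR where the key is good at `3`; [SilvermanAEC2009] X.4.14; [Miller2011LMS] Def. 1.1; [Cremona2006].
-/

set_option autoImplicit false

noncomputable section

open scoped Classical

open WeierstrassCurve Literature.NumberTheory.EllipticCurves
  Literature.NumberTheory.EllipticCurves.Rank1Residual
  Literature.NumberTheory.EllipticCurves.Rank1Residual.Typed
  Literature.NumberTheory.EllipticCurves.Rank1Residual.X11RankOneCertificates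
  Literature.NumberTheory.EllipticCurves.MazurRubin2015
  Literature.NumberTheory.EllipticCurves.Fisher2012
  Literature.NumberTheory.GaloisRepresentations
  Summit.BirchSwinnertonDyer.BirchSwinnertonDyer.Rank1Residual.IntModel
  Summit.BirchSwinnertonDyer.BirchSwinnertonDyer.Rank1Residual.X11RankOne
  Summit.BirchSwinnertonDyer.Rank1Residual.GaloisImage
  Summit.BirchSwinnertonDyer.Rank1Residual.X11b
open NumberField IsDedekindDomain

namespace Summit.BirchSwinnertonDyer.Rank1Residual.Visibility

/-! ### `317400y1 @ 3` (class X11b) — partner `317400b1` (rank 3) -/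

/-- **`BSD(E,3)` for `317400y1`** (class X11b; `N = 317400 = 2³·3·5²·23²`; at `3`: nonsplit multiplicative `I5` (`c₃ = 1`); bad primes `2`: I1* (`c = 2`), `5`: III* (`c = 2`), `23`: I2* (`c = 4`); `ρ̄_{E,3}` onto; `r_an = 1`; `#E(ℚ)_tors = 2`;
`∏ c_q = 16`; `#Ш_an = 9`; other members of the isogeny class by `bsdp_iff_of_isIsogenous`) from PUBLISHED theorems — Kolyvagin's index
bound (`hKo`, `hB`: McCallum 1991 §1 / Gross 1991 Thm. 1.3), Cassels–Tate (`hCT`), Gross–Zagier–Kolyvagin (`hGZK`) — plus the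
per-pair certificates: UPPER half = the lane's Heegner datum `K = ℚ(√-191)`, `[E(K):ℤy_K] = m = 48`, `ord₃ m = 1` (bsdN-sweep/0.1.2,
certified `4ρ`-ball; second field `D = -359`, `m = 192`; hyp ENGINE V `idx` T-KOLY `ord₃ m ≤ 1`), DISPLAYED as hK hH hP hnt hI; LOWER half =
k1-c3 g7's two-witness KERNEL record `missingLowerBoundAt_c317400y1_3_of_congr` (`Visibility/TwoWitnessLowerHalf317400y1.lean`: partner
`W' = 317400b1` of rank `3`, witnesses `T₁, T₂ ∈ W'(ℚ)` independent mod `3W'(ℚ)` and locally `3`-divisible / harmless on `S = {2, 3, 5, 23}`,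
`E[3]` irreducible, minimality, good reduction off `S` — all in the kernel) BY NAME, with the `3`-CONGRUENCE `θ : W'[3] ≃ E[3]` DISPLAYED
(certified outside the kernel: Kraus–Oesterlé `a_ℓ(E) ≡ a_ℓ(W') (mod 3)` for every `ℓ ≤ B = 132479` (`M = 317400`), TWO engines to the FULL
bound, hyp ENGINE V-A / V-B, `vis_triples.tsv.gz` row (317400y1, 3, 317400b1): `H_cong = 1` agree, `cong_full_two_engine = True`); `ρ̄_{E,3}` onto by the landed VIS30 kernel certificate `surj3_v317400y1` (x11c gen 6, two Frobenius point counts) by name. Composition = `X11b.padicValNat_shaOrder_le_of_kolyvagin` +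
`X11b.missingUpperBoundAt_of_padicValNat_shaOrder_le` + `bsdp_of_missingPPartAt`. Per pair; the lane / referee A book the verdict;
no label change; nothing booked here. [cite: McCallumLMS1991, §1 Theorem (Kolyvagin), p. 296] [cite: GrossLMS1991, Thm. 1.3]
[cite: CremonaMazur2000, §3 and Table 1] [cite: AgasheStein2002, Lemma 3.6] [cite: KrausOesterle1992, Prop. 4]
[cite: Miller2011LMS, §1 and Def. 1.1] [cite: Cremona2006, Table 1 (317400y1, 317400b1)] -/
theorem bsdp_w317400y1 (hCT : exists_casselsTate_pairing (K := ℚ))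
    (hGZK : rank_eq_analyticRank_of_analyticRank_le_one)
    (W : WeierstrassCurve ℚ) (hW : W = ⟨0, -1, 0, 3328292, 4068639412⟩)
    {N : ℕ} [NeZero N] {K : Type} [Field K] [NumberField K] (hKo : kolyvagin N W K)
    (hB : Kolyvagin1990_padicValNat_card_sha_le N W K) (hK : IsImaginaryQuadratic K)
    (hH : SatisfiesHeegnerHypothesis N K) {P : (W.baseChange K).toAffine.Point}
    (hP : IsHeegnerPoint N W K P) (hnt : ¬ IsOfFinAddOrder P)
    (hI : padicValNat 3 (AddSubgroup.zmultiples P).index ≤ 1)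
    (hr : W.analyticRank = 1) {s : ℚ} (hs : shaAn W = (s : ℂ)) (hv : padicValRat 3 s = 2)
    (W' : WeierstrassCurve ℚ) (hW' : W' = ⟨0, -1, 0, -153, 477⟩)
    (θ : geomTorsion W' (3 : ℤ) ≃+ geomTorsion W (3 : ℤ))
    (hθ : ∀ (σ : Field.absoluteGaloisGroup ℚ) (Q : geomTorsion W' (3 : ℤ)), θ (σ • Q) = σ • θ Q) :
    BSDp W 3 := by
  haveI : Fact (Nat.Prime 3) := ⟨by norm_num⟩
  subst hW hW'
  haveI := isElliptic_c317400y1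
  haveI := isGloballyMinimal_c317400y1
  haveI := Summit.BirchSwinnertonDyer.BirchSwinnertonDyer.Rank2Observatory.C317400b1.isElliptic
  haveI := isGloballyMinimal_c317400b1
  obtain ⟨-, hfin⟩ := hGZK (⟨0, -1, 0, 3328292, 4068639412⟩ : WeierstrassCurve ℚ) (by omega)
  have hρ : (⟨0, -1, 0, 3328292, 4068639412⟩ : WeierstrassCurve ℚ).HasSurjectiveModNGaloisRep 3 :=
    surj3_v317400y1 (integralModelInt_eq_of_map_eq _ (map_mk_int 0 (-1) 0 3328292 4068639412))
  -- LOWER half: k1-c3's two-witness kernel record, by name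
  have hlow : MissingLowerBoundAt (⟨0, -1, 0, 3328292, 4068639412⟩ : WeierstrassCurve ℚ) 3 :=
    missingLowerBoundAt_c317400y1_3_of_congr hCT hGZK rfl rfl hr hs hv.le θ hθ
  -- UPPER half: Kolyvagin at the displayed Heegner datum
  have hup : MissingUpperBoundAt (⟨0, -1, 0, 3328292, 4068639412⟩ : WeierstrassCurve ℚ) 3 :=
    X11b.missingUpperBoundAt_of_padicValNat_shaOrder_le _ 3 (k := 1)
      (X11b.padicValNat_shaOrder_le_of_kolyvagin _ 3 hKo hB hK hH hP hnt (by norm_num) hρ hfin hI) hs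
      (by rw [hv]; norm_num)
  exact bsdp_of_missingPPartAt _ 3 hGZK (by omega) (missingPPartAt_of_lower_of_upper _ 3 hlow hup)

/-- **`bsdp_w317400y1` with θ/hθ DISCHARGED IN THE KERNEL** (HESSE GRADE, the n1011 ROW T-VIS3-TH twin pattern of VIS30's
`bsdpHesse_v<label>`): the partner `317400b1` is `ℚ`-isomorphic to the member `(l : m) = (-11500 : 1)` (`u = 317400`) of the DIRECT (`X_E(3)`)
Hesse pencil of `E` (Fisher 2012 Thm. 13.2, `n = 3`; unconditional: `threeCongruent_of_hesseCertificate_unconditional`; certificate found by n1011's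
`tvis3_hesse3_search.py` (f7173afc…) run by this unit, complete rational-root search of the degree-12 `j`-equation), so
`θ : W'[3] ≃ E[3]` comes from ONE call of `VisCerts.torsionIso3_of_hesseCert_mk` with ten `norm_num` identities. Remaining binders:
hCT hGZK W hW hKo hB hK hH hP hnt hI hr hs hv ⊢ `BSDp W 3` — NO θ, NO partner datum, NO local-torsion binder. Per pair; nothing booked.
[cite: Fisher2012Hessian, Thm. 13.2 (n = 3)] [cite: CremonaAlgorithms1997, §3.5] -/
theorem bsdpHesse_w317400y1 (hCT : exists_casselsTate_pairing (K := ℚ))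
    (hGZK : rank_eq_analyticRank_of_analyticRank_le_one)
    (W : WeierstrassCurve ℚ) (hW : W = ⟨0, -1, 0, 3328292, 4068639412⟩)
    {N : ℕ} [NeZero N] {K : Type} [Field K] [NumberField K] (hKo : kolyvagin N W K)
    (hB : Kolyvagin1990_padicValNat_card_sha_le N W K) (hK : IsImaginaryQuadratic K)
    (hH : SatisfiesHeegnerHypothesis N K) {P : (W.baseChange K).toAffine.Point}
    (hP : IsHeegnerPoint N W K P) (hnt : ¬ IsOfFinAddOrder P)
    (hI : padicValNat 3 (AddSubgroup.zmultiples P).index ≤ 1)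
    (hr : W.analyticRank = 1) {s : ℚ} (hs : shaAn W = (s : ℂ)) (hv : padicValRat 3 s = 2) :
    BSDp W 3 := by
  haveI : (⟨0, -1, 0, -153, 477⟩ : WeierstrassCurve ℚ).IsElliptic := Summit.BirchSwinnertonDyer.BirchSwinnertonDyer.Rank2Observatory.C317400b1.isElliptic
  have hWlit : W = ⟨0, -1, 0, 3328292, 4068639412⟩ := hW
  haveI : W.IsElliptic := by rw [hWlit]; exact isElliptic_c317400y1
  obtain ⟨θ, hθ⟩ := VisCerts.torsionIso3_of_hesseCert_mk
    (W' := (⟨0, -1, 0, -153, 477⟩ : WeierstrassCurve ℚ)) hWlit rfl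
    (-159758000) (-3516263000000) 7360 (-368000) (by norm_num) (by norm_num) (by norm_num) (by norm_num)
    (-11500) 1 317400 (by norm_num) (by norm_num) (by norm_num)
  exact bsdp_w317400y1 hCT hGZK W hW hKo hB hK hH hP hnt hI hr hs hv _ rfl θ hθ

/-! ### `338919c1 @ 3` (class X11b) — partner `338919a1` (rank 3) -/

/-- **`BSD(E,3)` for `338919c1`** (class X11b; `N = 338919 = 3·7·16139`; at `3`: split multiplicative `I1` (`c₃ = 1`); bad primes `7`: I14 (`c = 2`), `16139`: I1 (`c = 1`); `ρ̄_{E,3}` onto; `r_an = 1`; `#E(ℚ)_tors = 1`;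
`∏ c_q = 2`; `#Ш_an = 9`; other members of the isogeny class by `bsdp_iff_of_isIsogenous`) from PUBLISHED theorems — Kolyvagin's index
bound (`hKo`, `hB`: McCallum 1991 §1 / Gross 1991 Thm. 1.3), Cassels–Tate (`hCT`), Gross–Zagier–Kolyvagin (`hGZK`) — plus the
per-pair certificates: UPPER half = the lane's Heegner datum `K = ℚ(√-68)`, `[E(K):ℤy_K] = m = 12`, `ord₃ m = 1` (bsdN-sweep/0.1.2,
certified `4ρ`-ball; second field `D = -83`, `m = 12`; hyp ENGINE V `idx` T-KOLY `ord₃ m ≤ 1`), DISPLAYED as hK hH hP hnt hI; LOWER half =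
k1-c3 g7's two-witness KERNEL record `missingLowerBoundAt_c338919c1_3_of_congr` (`Visibility/TwoWitnessLowerHalf338919c1.lean`: partner
`W' = 338919a1` of rank `3`, witnesses `T₁, T₂ ∈ W'(ℚ)` independent mod `3W'(ℚ)` and locally `3`-divisible / harmless on `S = {3, 7, 16139}`,
`E[3]` irreducible, minimality, good reduction off `S` — all in the kernel) BY NAME, with the `3`-CONGRUENCE `θ : W'[3] ≃ E[3]` DISPLAYED
(certified outside the kernel: Kraus–Oesterlé `a_ℓ(E) ≡ a_ℓ(W') (mod 3)` for every `ℓ ≤ B = 86079` (`M = 338919`), TWO engines to the FULL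
bound, hyp ENGINE V-A / V-B, `vis_triples.tsv.gz` row (338919c1, 3, 338919a1): `H_cong = 1` agree, `cong_full_two_engine = True`); `ρ̄_{E,3}` onto by the landed VIS30 kernel certificate `surj3_v338919c1` (x11c gen 6, two Frobenius point counts) by name. Composition = `X11b.padicValNat_shaOrder_le_of_kolyvagin` +
`X11b.missingUpperBoundAt_of_padicValNat_shaOrder_le` + `bsdp_of_missingPPartAt`. Per pair; the lane / referee A book the verdict;
no label change; nothing booked here. [cite: McCallumLMS1991, §1 Theorem (Kolyvagin), p. 296] [cite: GrossLMS1991, Thm. 1.3]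
[cite: CremonaMazur2000, §3 and Table 1] [cite: AgasheStein2002, Lemma 3.6] [cite: KrausOesterle1992, Prop. 4]
[cite: Miller2011LMS, §1 and Def. 1.1] [cite: Cremona2006, Table 1 (338919c1, 338919a1)] -/
theorem bsdp_w338919c1 (hCT : exists_casselsTate_pairing (K := ℚ))
    (hGZK : rank_eq_analyticRank_of_analyticRank_le_one)
    (W : WeierstrassCurve ℚ) (hW : W = ⟨1, 0, 1, -291161, -61120495⟩)
    {N : ℕ} [NeZero N] {K : Type} [Field K] [NumberField K] (hKo : kolyvagin N W K)
    (hB : Kolyvagin1990_padicValNat_card_sha_le N W K) (hK : IsImaginaryQuadratic K)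
    (hH : SatisfiesHeegnerHypothesis N K) {P : (W.baseChange K).toAffine.Point}
    (hP : IsHeegnerPoint N W K P) (hnt : ¬ IsOfFinAddOrder P)
    (hI : padicValNat 3 (AddSubgroup.zmultiples P).index ≤ 1)
    (hr : W.analyticRank = 1) {s : ℚ} (hs : shaAn W = (s : ℂ)) (hv : padicValRat 3 s = 2)
    (W' : WeierstrassCurve ℚ) (hW' : W' = ⟨0, 1, 1, -162, 830⟩)
    (θ : geomTorsion W' (3 : ℤ) ≃+ geomTorsion W (3 : ℤ))
    (hθ : ∀ (σ : Field.absoluteGaloisGroup ℚ) (Q : geomTorsion W' (3 : ℤ)), θ (σ • Q) = σ • θ Q) :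
    BSDp W 3 := by
  haveI : Fact (Nat.Prime 3) := ⟨by norm_num⟩
  subst hW hW'
  haveI := isElliptic_c338919c1
  haveI := isGloballyMinimal_c338919c1
  haveI := isElliptic_c338919a1
  haveI := isGloballyMinimal_c338919a1
  obtain ⟨-, hfin⟩ := hGZK (⟨1, 0, 1, -291161, -61120495⟩ : WeierstrassCurve ℚ) (by omega)
  have hρ : (⟨1, 0, 1, -291161, -61120495⟩ : WeierstrassCurve ℚ).HasSurjectiveModNGaloisRep 3 :=
    surj3_v338919c1 (integralModelInt_eq_of_map_eq _ (map_mk_int 1 0 1 (-291161) (-61120495)))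
  -- LOWER half: k1-c3's two-witness kernel record, by name
  have hlow : MissingLowerBoundAt (⟨1, 0, 1, -291161, -61120495⟩ : WeierstrassCurve ℚ) 3 :=
    missingLowerBoundAt_c338919c1_3_of_congr hCT hGZK rfl rfl hr hs hv.le θ hθ
  -- UPPER half: Kolyvagin at the displayed Heegner datum
  have hup : MissingUpperBoundAt (⟨1, 0, 1, -291161, -61120495⟩ : WeierstrassCurve ℚ) 3 :=
    X11b.missingUpperBoundAt_of_padicValNat_shaOrder_le _ 3 (k := 1)
      (X11b.padicValNat_shaOrder_le_of_kolyvagin _ 3 hKo hB hK hH hP hnt (by norm_num) hρ hfin hI) hs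
      (by rw [hv]; norm_num)
  exact bsdp_of_missingPPartAt _ 3 hGZK (by omega) (missingPPartAt_of_lower_of_upper _ 3 hlow hup)

/-- **`bsdp_w338919c1` with θ/hθ DISCHARGED IN THE KERNEL** (HESSE GRADE, the n1011 ROW T-VIS3-TH twin pattern of VIS30's
`bsdpHesse_v<label>`): the partner `338919a1` is `ℚ`-isomorphic to the member `(l : m) = (-3147 : 1)` (`u = 9604`) of the DIRECT (`X_E(3)`)
Hesse pencil of `E` (Fisher 2012 Thm. 13.2, `n = 3`; unconditional: `threeCongruent_of_hesseCertificate_unconditional`; certificate found by n1011's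
`tvis3_hesse3_search.py` (f7173afc…) run by this unit, complete rational-root search of the degree-12 `j`-equation), so
`θ : W'[3] ≃ E[3]` comes from ONE call of `VisCerts.torsionIso3_of_hesseCert_mk` with ten `norm_num` identities. Remaining binders:
hCT hGZK W hW hKo hB hK hH hP hnt hI hr hs hv ⊢ `BSDp W 3` — NO θ, NO partner datum, NO local-torsion binder. Per pair; nothing booked.
[cite: Fisher2012Hessian, Thm. 13.2 (n = 3)] [cite: CremonaAlgorithms1997, §3.5] -/
theorem bsdpHesse_w338919c1 (hCT : exists_casselsTate_pairing (K := ℚ))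
    (hGZK : rank_eq_analyticRank_of_analyticRank_le_one)
    (W : WeierstrassCurve ℚ) (hW : W = ⟨1, 0, 1, -291161, -61120495⟩)
    {N : ℕ} [NeZero N] {K : Type} [Field K] [NumberField K] (hKo : kolyvagin N W K)
    (hB : Kolyvagin1990_padicValNat_card_sha_le N W K) (hK : IsImaginaryQuadratic K)
    (hH : SatisfiesHeegnerHypothesis N K) {P : (W.baseChange K).toAffine.Point}
    (hP : IsHeegnerPoint N W K P) (hnt : ¬ IsOfFinAddOrder P)
    (hI : padicValNat 3 (AddSubgroup.zmultiples P).index ≤ 1)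
    (hr : W.analyticRank = 1) {s : ℚ} (hs : shaAn W = (s : ℂ)) (hv : padicValRat 3 s = 2) :
    BSDp W 3 := by
  haveI : (⟨0, 1, 1, -162, 830⟩ : WeierstrassCurve ℚ).IsElliptic := isElliptic_c338919a1
  have hWlit : W = ⟨1, 0, 1, -291161, -61120495⟩ := hW
  haveI : W.IsElliptic := by rw [hWlit]; exact isElliptic_c338919c1
  obtain ⟨θ, hθ⟩ := VisCerts.torsionIso3_of_hesseCert_mk
    (W' := (⟨0, 1, 1, -162, 830⟩ : WeierstrassCurve ℚ)) hWlit rfl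
    13975705 52787143907 7792 (-764056) (by norm_num) (by norm_num) (by norm_num) (by norm_num)
    (-3147) 1 9604 (by norm_num) (by norm_num) (by norm_num)
  exact bsdp_w338919c1 hCT hGZK W hW hKo hB hK hH hP hnt hI hr hs hv _ rfl θ hθ

/-! ### `355008bg1 @ 3` (class X11b) — partner `118336bj1` (rank 3) -/

/-- **`BSD(E,3)` for `355008bg1`** (class X11b; `N = 355008 = 2⁶·3·43²`; at `3`: nonsplit multiplicative `I6` (`c₃ = 2`); bad primes `2`: II (`c = 1`), `43`: I1* (`c = 4`); `ρ̄_{E,3}` onto; `r_an = 1`; `#E(ℚ)_tors = 2`;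
`∏ c_q = 8`; `#Ш_an = 9`; other members of the isogeny class by `bsdp_iff_of_isIsogenous`) from PUBLISHED theorems — Kolyvagin's index
bound (`hKo`, `hB`: McCallum 1991 §1 / Gross 1991 Thm. 1.3), Cassels–Tate (`hCT`), Gross–Zagier–Kolyvagin (`hGZK`) — plus the
per-pair certificates: UPPER half = the lane's Heegner datum `K = ℚ(√-71)`, `[E(K):ℤy_K] = m = 48`, `ord₃ m = 1` (bsdN-sweep/0.1.2,
certified `4ρ`-ball; second field `D = -191`, `m = 24`; hyp ENGINE V `idx` T-KOLY `ord₃ m ≤ 1`), DISPLAYED as hK hH hP hnt hI; LOWER half =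
k1-c3 g7's two-witness KERNEL record `missingLowerBoundAt_c355008bg1_3_of_congr` (`Visibility/TwoWitnessLowerHalf355008bg1.lean`: partner
`W' = 118336bj1` of rank `3`, witnesses `T₁, T₂ ∈ W'(ℚ)` independent mod `3W'(ℚ)` and locally `3`-divisible / harmless on `S = {2, 3, 43}`,
`E[3]` irreducible, minimality, good reduction off `S` — all in the kernel) BY NAME, with the `3`-CONGRUENCE `θ : W'[3] ≃ E[3]` DISPLAYED
(certified outside the kernel: Kraus–Oesterlé `a_ℓ(E) ≡ a_ℓ(W') (mod 3)` for every `ℓ ≤ B = 121087` (`M = 355008`), TWO engines to the FULL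
bound, hyp ENGINE V-A / V-B, `vis_triples.tsv.gz` row (355008bg1, 3, 118336bj1): `H_cong = 1` agree, `cong_full_two_engine = True`); `ρ̄_{E,3}` onto by the landed VIS30 kernel certificate `surj3_v355008bg1` (x11c gen 6, two Frobenius point counts) by name. Composition = `X11b.padicValNat_shaOrder_le_of_kolyvagin` +
`X11b.missingUpperBoundAt_of_padicValNat_shaOrder_le` + `bsdp_of_missingPPartAt`. Per pair; the lane / referee A book the verdict;
no label change; nothing booked here. [cite: McCallumLMS1991, §1 Theorem (Kolyvagin), p. 296] [cite: GrossLMS1991, Thm. 1.3]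
[cite: CremonaMazur2000, §3 and Table 1] [cite: AgasheStein2002, Lemma 3.6] [cite: KrausOesterle1992, Prop. 4]
[cite: Miller2011LMS, §1 and Def. 1.1] [cite: Cremona2006, Table 1 (355008bg1, 118336bj1)] -/
theorem bsdp_w355008bg1 (hCT : exists_casselsTate_pairing (K := ℚ))
    (hGZK : rank_eq_analyticRank_of_analyticRank_le_one)
    (W : WeierstrassCurve ℚ) (hW : W = ⟨0, -1, 0, -89368, 8769670⟩)
    {N : ℕ} [NeZero N] {K : Type} [Field K] [NumberField K] (hKo : kolyvagin N W K)
    (hB : Kolyvagin1990_padicValNat_card_sha_le N W K) (hK : IsImaginaryQuadratic K)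
    (hH : SatisfiesHeegnerHypothesis N K) {P : (W.baseChange K).toAffine.Point}
    (hP : IsHeegnerPoint N W K P) (hnt : ¬ IsOfFinAddOrder P)
    (hI : padicValNat 3 (AddSubgroup.zmultiples P).index ≤ 1)
    (hr : W.analyticRank = 1) {s : ℚ} (hs : shaAn W = (s : ℂ)) (hv : padicValRat 3 s = 2)
    (W' : WeierstrassCurve ℚ) (hW' : W' = ⟨0, -1, 0, -57, 121⟩)
    (θ : geomTorsion W' (3 : ℤ) ≃+ geomTorsion W (3 : ℤ))
    (hθ : ∀ (σ : Field.absoluteGaloisGroup ℚ) (Q : geomTorsion W' (3 : ℤ)), θ (σ • Q) = σ • θ Q) :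
    BSDp W 3 := by
  haveI : Fact (Nat.Prime 3) := ⟨by norm_num⟩
  subst hW hW'
  haveI := isElliptic_c355008bg1
  haveI := isGloballyMinimal_c355008bg1
  haveI := isElliptic_c118336bj1
  haveI := isGloballyMinimal_c118336bj1
  obtain ⟨-, hfin⟩ := hGZK (⟨0, -1, 0, -89368, 8769670⟩ : WeierstrassCurve ℚ) (by omega)
  have hρ : (⟨0, -1, 0, -89368, 8769670⟩ : WeierstrassCurve ℚ).HasSurjectiveModNGaloisRep 3 :=
    surj3_v355008bg1 (integralModelInt_eq_of_map_eq _ (map_mk_int 0 (-1) 0 (-89368) 8769670))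
  -- LOWER half: k1-c3's two-witness kernel record, by name
  have hlow : MissingLowerBoundAt (⟨0, -1, 0, -89368, 8769670⟩ : WeierstrassCurve ℚ) 3 :=
    missingLowerBoundAt_c355008bg1_3_of_congr hCT hGZK rfl rfl hr hs hv.le θ hθ
  -- UPPER half: Kolyvagin at the displayed Heegner datum
  have hup : MissingUpperBoundAt (⟨0, -1, 0, -89368, 8769670⟩ : WeierstrassCurve ℚ) 3 :=
    X11b.missingUpperBoundAt_of_padicValNat_shaOrder_le _ 3 (k := 1)
      (X11b.padicValNat_shaOrder_le_of_kolyvagin _ 3 hKo hB hK hH hP hnt (by norm_num) hρ hfin hI) hs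
      (by rw [hv]; norm_num)
  exact bsdp_of_missingPPartAt _ 3 hGZK (by omega) (missingPPartAt_of_lower_of_upper _ 3 hlow hup)

/-- **`bsdp_w355008bg1` with θ/hθ DISCHARGED IN THE KERNEL** (HESSE GRADE, the n1011 ROW T-VIS3-TH twin pattern of VIS30's
`bsdpHesse_v<label>`): the partner `118336bj1` is `ℚ`-isomorphic to the member `(l : m) = (1376 : 1)` (`u = 1/344`) of the DUAL (`X_E⁻(3)`)
Hesse pencil of `E` (Fisher 2012 Thm. 13.2, `n = 3`; the tree THEOREM `Fisher2012.thm132rev_threeCongruent_dualHessePencil_holds` (A243 discharged); certificate found by n1011's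
`tvis3_hesse3_search.py` (f7173afc…) run by this unit, complete rational-root search of the degree-12 `j`-equation), so
`θ : W'[3] ≃ E[3]` comes from ONE call of `VisCerts.torsionIso3_of_dualHesseCert_mk` with ten `norm_num` identities. Remaining binders:
hCT hGZK W hW hKo hB hK hH hP hnt hI hr hs hv ⊢ `BSDp W 3` — NO θ, NO partner datum, NO local-torsion binder. Per pair; nothing booked.
[cite: Fisher2012Hessian, Thm. 13.2 (n = 3)] [cite: CremonaAlgorithms1997, §3.5] -/
theorem bsdpHesse_w355008bg1 (hCT : exists_casselsTate_pairing (K := ℚ))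
    (hGZK : rank_eq_analyticRank_of_analyticRank_le_one)
    (W : WeierstrassCurve ℚ) (hW : W = ⟨0, -1, 0, -89368, 8769670⟩)
    {N : ℕ} [NeZero N] {K : Type} [Field K] [NumberField K] (hKo : kolyvagin N W K)
    (hB : Kolyvagin1990_padicValNat_card_sha_le N W K) (hK : IsImaginaryQuadratic K)
    (hH : SatisfiesHeegnerHypothesis N K) {P : (W.baseChange K).toAffine.Point}
    (hP : IsHeegnerPoint N W K P) (hnt : ¬ IsOfFinAddOrder P)
    (hI : padicValNat 3 (AddSubgroup.zmultiples P).index ≤ 1)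
    (hr : W.analyticRank = 1) {s : ℚ} (hs : shaAn W = (s : ℂ)) (hv : padicValRat 3 s = 2) :
    BSDp W 3 := by
  haveI : (⟨0, -1, 0, -57, 121⟩ : WeierstrassCurve ℚ).IsElliptic := isElliptic_c118336bj1
  have hWlit : W = ⟨0, -1, 0, -89368, 8769670⟩ := hW
  haveI : W.IsElliptic := by rw [hWlit]; exact isElliptic_c355008bg1
  obtain ⟨θ, hθ⟩ := VisCerts.torsionIso3_of_dualHesseCert_mk thm132rev_threeCongruent_dualHessePencil_holds
    (W' := (⟨0, -1, 0, -57, 121⟩ : WeierstrassCurve ℚ)) hWlit rfl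
    4289680 (-7551256832) 2752 (-88064) (by norm_num) (by norm_num) (by norm_num) (by norm_num)
    1376 1 (1/344 : ℚ) (by norm_num) (by norm_num) (by norm_num)
  exact bsdp_w355008bg1 hCT hGZK W hW hKo hB hK hH hP hnt hI hr hs hv _ rfl θ hθ

end Summit.BirchSwinnertonDyer.Rank1Residual.Visibility

end
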